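import Summits.ResolutionOfSingularities.ResolutionOfSingularities.Theorems.FrobeniusLadderFInjectiveMacaulayficationFDSpecimen
import Summits.ResolutionOfSingularities.ResolutionOfSingularities.Theorems.FrobeniusLadderFInjectiveMacaulayficationGoodSupportDominated
import HarnessLib

/-!
# `f′ = σ₇(f_Lx6q7d5) = z² + x⁶z + x¹³ + x¹⁴ + y³ + u³ + t³ + s⁷` (char 2): the INPUT FACTS of the class row — prime, no variable vanishes, regular off the vertex, and
# ★ WEAKLY NON-DEGENERATE ALONG EVERY POSITIVE WEIGHT (six variables; the coordinate-dependent hypothesis that the shift `σ₇ : z ↦ z + x⁷` buys)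
# (crux `FInjectiveMacaulayfication` stmt-ResolutionOfSingularities-15315, chain w45a; (W-WND) class-route COVERAGE PROGRAMME (n = 6), res-L1-w45a-plan-1 RULING R22.14 (2) / R22.2;
# seat res-L1-w45a-stub-2 g11; template = res-L1-w45a-stub-3 g11ʼs `FDSpecimen` §1 and `FDStorey2WND`; evidence-level twin = res-L1-w45a-tri-2 g19 `R222-WND-fprime-tri2.md`
# 882bb80633cda426: 47 compact faces, hWND 47/47)

[OURS · L1 W4.5a] Support file (`--supports stmt-ResolutionOfSingularities-15315 --as helper`); def-free, unconditional; replaces the role of NO printed item; NOT a statement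
of the manuscript; AI-written (AI review is weaker than expert review).

`X 0 = x`, `X 1 = y`, `X 2 = u`, `X 3 = t`, `X 4 = s`, `X 5 = z`; `f′ = z² + x⁶z + x¹³ + x¹⁴ + y³ + u³ + t³ + s⁷ = f_Lx6q7d5(x,y,u,t,s,z+x⁷)` (`f_Lx6q7d5 = z² + x⁶z + y³ + u³ + t³ + s⁷`, the (5,2) census bed of row (5,2) #2 ✓ p658464), ANY field `k` of characteristic 2 unless stated.
* §1 `casts_char2`, `pderiv_zero_f` (`∂_x f′ = x¹²`), `pderiv_cube_f` (`∂_y,∂_u,∂_t f′ = y², u², t²`), `pderiv_four_f` (`∂_s f′ = s⁶`), `pderiv_five_f` (`∂_z f′ = x⁶`), `constantCoeff_f`, ★ `prime_f` (Eisenstein-type in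
  `T = z`: `T² + C(x⁶)T + C(c)`, `c = x¹³+x¹⁴+y³+u³+t³+s⁷`, at `(x,y,u,t,s) = (0,0,1,1,0)`: `x⁶ = 0`, `c = 1+1 = 0`, `∂_u c = 3u² = 1 ≠ 0`), `regular_off_vertex` (= the class rows' `hreg`:
  Jacobian off `𝔪` with `x⁶, y², u², t², s⁶`; `z` alone cannot miss a prime containing `x,y,u,t,s`: `z² = f′ − …`), `isPrime_span_f`, `f_not_mem_span_X`, ★ `mk_X_ne_zero` (= `hXne`);
* §2 ★★ `weaklyNondegenerate` — `f′` is WEAKLY NON-DEGENERATE along every positive weight, by the «good support» criterion VERSION 2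
  (`CensusBedsWeaklyNondegenerate.weaklyNondegenerate_of_good_support'`, ✓ `GoodSupportDominated`): `β₀ = 2e_z`; `x⁶z` is good via `z` (exponent 1; even elsewhere), `x¹³` via `x`
  (13 odd; `6, 14` even elsewhere), `y³, u³, t³, s⁷` in private variables, and `x¹⁴` is DOMINATED by `x¹³` (lies on no compact face). The census bed d5lx6q7 itself is not convenient in `x`; `f′` is (`x¹³`).
[folklore mathematics, OURS as a certificate; cite: Hartshorne1977, I Thm. 5.1; BoubakriGreuelMarkwig2010, §3 (p. 10)]
-/

-- single-problem summit: the doubled namespace component is forced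
set_option linter.dupNamespace false

noncomputable section

open AlgebraicGeometry CategoryTheory Literature.AlgebraicGeometry.Resolution TopologicalSpace IsLocalRing MvPolynomial

namespace Summit.ResolutionOfSingularities.ResolutionOfSingularities.Theorems.FInjectiveMacaulayfication.Sigma7Lx6q7d5Specimen

open Summit.ResolutionOfSingularities.ResolutionOfSingularities.Theorems.FInjectiveMacaulayfication
open Literature.AlgebraicGeometry.Resolution.BoubakriGreuelMarkwig

/-! ## §1 Derivatives, primality, regularity off the vertex, no variable vanishes -/

/-- In characteristic `2`: `3 = 1`, `6 = 0`, `13 = 1`, `14 = 0`, `7 = 1` in `k[X]`. [folklore] -/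
theorem casts_char2 (k : Type) [Field k] [CharP k 2] :
    (3 : MvPolynomial (Fin 6) k) = 1 ∧ (6 : MvPolynomial (Fin 6) k) = 0 ∧ (13 : MvPolynomial (Fin 6) k) = 1 ∧ (14 : MvPolynomial (Fin 6) k) = 0 ∧ (7 : MvPolynomial (Fin 6) k) = 1 := by
  have h2 : (2 : MvPolynomial (Fin 6) k) = 0 := (FermatCubicConeChar2.two_three k (n := 6)).1
  refine ⟨?_, ?_, ?_, ?_, ?_⟩
  · calc (3 : MvPolynomial (Fin 6) k) = 2 + 1 := by norm_num
      _ = 1 := by rw [h2]; ring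
  · calc (6 : MvPolynomial (Fin 6) k) = 2 * 3 := by norm_num
      _ = 0 := by rw [h2]; ring
  · calc (13 : MvPolynomial (Fin 6) k) = 2 * 6 + 1 := by norm_num
      _ = 1 := by rw [h2]; ring
  · calc (14 : MvPolynomial (Fin 6) k) = 2 * 7 := by norm_num
      _ = 0 := by rw [h2]; ring
  · calc (7 : MvPolynomial (Fin 6) k) = 2 * 3 + 1 := by norm_num
      _ = 1 := by rw [h2]; ring

/-- `∂f′/∂x = 6x⁵z + 13x¹² + 14x¹³ = x¹²` in characteristic 2. [folklore] -/
theorem pderiv_zero_f (k : Type) [Field k] [CharP k 2] (f : MvPolynomial (Fin 6) k)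
    (hf : f = X 5 ^ 2 + X 0 ^ 6 * X 5 + X 0 ^ 13 + X 0 ^ 14 + X 1 ^ 3 + X 2 ^ 3 + X 3 ^ 3 + X 4 ^ 7) : pderiv 0 f = X 0 ^ 12 := by
  obtain ⟨-, h4, h9, h10, -⟩ := casts_char2 k
  rw [hf]
  simp only [map_add, Derivation.leibniz, pderiv_pow, pderiv_X_self, pderiv_X_of_ne (show (5 : Fin 6) ≠ 0 by decide),
    pderiv_X_of_ne (show (1 : Fin 6) ≠ 0 by decide), pderiv_X_of_ne (show (2 : Fin 6) ≠ 0 by decide),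
    pderiv_X_of_ne (show (3 : Fin 6) ≠ 0 by decide), pderiv_X_of_ne (show (4 : Fin 6) ≠ 0 by decide), smul_eq_mul, mul_zero, mul_one, add_zero, zero_add]
  push_cast
  rw [h4, h9, h10]
  ring

/-- `∂f′/∂y = y²`, `∂f′/∂u = u²`, `∂f′/∂t = t²` in characteristic 2. [folklore] -/
theorem pderiv_cube_f (k : Type) [Field k] [CharP k 2] (f : MvPolynomial (Fin 6) k)
    (hf : f = X 5 ^ 2 + X 0 ^ 6 * X 5 + X 0 ^ 13 + X 0 ^ 14 + X 1 ^ 3 + X 2 ^ 3 + X 3 ^ 3 + X 4 ^ 7) (j : Fin 6) (hj : j = 1 ∨ j = 2 ∨ j = 3) :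
    pderiv j f = X j ^ 2 := by
  obtain ⟨h3, -, -, -, -⟩ := casts_char2 k
  rw [hf]
  rcases hj with rfl | rfl | rfl
  all_goals
    simp only [map_add, Derivation.leibniz, pderiv_pow, pderiv_X_self, smul_eq_mul,
      pderiv_X_of_ne (show (0 : Fin 6) ≠ 1 by decide), pderiv_X_of_ne (show (2 : Fin 6) ≠ 1 by decide), pderiv_X_of_ne (show (3 : Fin 6) ≠ 1 by decide), pderiv_X_of_ne (show (4 : Fin 6) ≠ 1 by decide), pderiv_X_of_ne (show (5 : Fin 6) ≠ 1 by decide),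
      pderiv_X_of_ne (show (0 : Fin 6) ≠ 2 by decide), pderiv_X_of_ne (show (1 : Fin 6) ≠ 2 by decide), pderiv_X_of_ne (show (3 : Fin 6) ≠ 2 by decide), pderiv_X_of_ne (show (4 : Fin 6) ≠ 2 by decide), pderiv_X_of_ne (show (5 : Fin 6) ≠ 2 by decide),
      pderiv_X_of_ne (show (0 : Fin 6) ≠ 3 by decide), pderiv_X_of_ne (show (1 : Fin 6) ≠ 3 by decide), pderiv_X_of_ne (show (2 : Fin 6) ≠ 3 by decide), pderiv_X_of_ne (show (4 : Fin 6) ≠ 3 by decide), pderiv_X_of_ne (show (5 : Fin 6) ≠ 3 by decide), mul_zero, mul_one, zero_add, add_zero]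
    push_cast
    rw [h3]
    ring

/-- `∂f′/∂s = 7s⁶ = s⁶` in characteristic 2 (`s = X 4`). [folklore] -/
theorem pderiv_four_f (k : Type) [Field k] [CharP k 2] (f : MvPolynomial (Fin 6) k)
    (hf : f = X 5 ^ 2 + X 0 ^ 6 * X 5 + X 0 ^ 13 + X 0 ^ 14 + X 1 ^ 3 + X 2 ^ 3 + X 3 ^ 3 + X 4 ^ 7) : pderiv 4 f = X 4 ^ 6 := by
  obtain ⟨-, -, -, -, h7⟩ := casts_char2 k
  rw [hf]
  simp only [map_add, Derivation.leibniz, pderiv_pow, pderiv_X_self, smul_eq_mul,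
    pderiv_X_of_ne (show (0 : Fin 6) ≠ 4 by decide), pderiv_X_of_ne (show (1 : Fin 6) ≠ 4 by decide), pderiv_X_of_ne (show (2 : Fin 6) ≠ 4 by decide), pderiv_X_of_ne (show (3 : Fin 6) ≠ 4 by decide), pderiv_X_of_ne (show (5 : Fin 6) ≠ 4 by decide), mul_zero, mul_one, zero_add, add_zero]
  push_cast
  rw [h7]
  ring

/-- `∂f′/∂z = 2z + x⁶ = x⁶` in characteristic 2 (`z = X 5`). [folklore] -/
theorem pderiv_five_f (k : Type) [Field k] [CharP k 2] (f : MvPolynomial (Fin 6) k)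
    (hf : f = X 5 ^ 2 + X 0 ^ 6 * X 5 + X 0 ^ 13 + X 0 ^ 14 + X 1 ^ 3 + X 2 ^ 3 + X 3 ^ 3 + X 4 ^ 7) : pderiv 5 f = X 0 ^ 6 := by
  have h2 : (2 : MvPolynomial (Fin 6) k) = 0 := (FermatCubicConeChar2.two_three k (n := 6)).1
  rw [hf]
  simp only [map_add, Derivation.leibniz, pderiv_pow, pderiv_X_self, smul_eq_mul, pderiv_X_of_ne (show (0 : Fin 6) ≠ 5 by decide),
    pderiv_X_of_ne (show (1 : Fin 6) ≠ 5 by decide), pderiv_X_of_ne (show (2 : Fin 6) ≠ 5 by decide),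
    pderiv_X_of_ne (show (3 : Fin 6) ≠ 5 by decide), pderiv_X_of_ne (show (4 : Fin 6) ≠ 5 by decide), mul_zero, mul_one, add_zero]
  push_cast
  rw [h2]
  ring

/-- `f′` has no constant term. [folklore] -/
theorem constantCoeff_f (k : Type) [Field k] (f : MvPolynomial (Fin 6) k)
    (hf : f = X 5 ^ 2 + X 0 ^ 6 * X 5 + X 0 ^ 13 + X 0 ^ 14 + X 1 ^ 3 + X 2 ^ 3 + X 3 ^ 3 + X 4 ^ 7) : constantCoeff f = 0 := by
  rw [hf]
  simp [constantCoeff_X]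

/-- ★ **`f′` is PRIME** (any field of characteristic 2): as `T² + C(x⁶)·T + C(c)` in `T = z`, `c = x¹³ + x¹⁴ + y³ + u³ + t³ + s⁷`, Eisenstein-type at
`(x,y,u,t) = (0,0,1,1)` where `x⁶ = 0`, `c = 1 + 1 = 0` and `∂_u c = 3u² = 1 ≠ 0`. [folklore] -/
theorem prime_f (k : Type) [Field k] [CharP k 2] (f : MvPolynomial (Fin 6) k)
    (hf : f = X 5 ^ 2 + X 0 ^ 6 * X 5 + X 0 ^ 13 + X 0 ^ 14 + X 1 ^ 3 + X 2 ^ 3 + X 3 ^ 3 + X 4 ^ 7) : Prime f := by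
  set e : MvPolynomial (Fin 6) k ≃+* Polynomial (MvPolynomial (Fin 5) k) :=
    ((renameEquiv k (_root_.finRotate 6)).trans (finSuccEquiv k 5)).toRingEquiv with he_def
  have hrot5 : (_root_.finRotate 6) (5 : Fin 6) = 0 := by decide
  have hrot : ∀ j : Fin 5, (_root_.finRotate 6) (Fin.castSucc j) = j.succ := by decide
  have he5 : e (X 5) = Polynomial.X := by
    show finSuccEquiv k 5 (rename _ (X 5)) = _
    rw [rename_X, hrot5]; exact finSuccEquiv_X_zero
  have hej : ∀ j : Fin 5, e (X (Fin.castSucc j)) = Polynomial.C (X j) := fun j => by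
    show finSuccEquiv k 5 (rename _ (X (Fin.castSucc j))) = _
    rw [rename_X, hrot j]; exact finSuccEquiv_X_succ (j := j)
  set b : MvPolynomial (Fin 5) k := X 0 ^ 6 with hb
  set c : MvPolynomial (Fin 5) k := X 0 ^ 13 + X 0 ^ 14 + X 1 ^ 3 + X 2 ^ 3 + X 3 ^ 3 + X 4 ^ 7 with hc
  have hef : e f = Polynomial.X ^ 2 + Polynomial.C b * Polynomial.X + Polynomial.C c := by
    rw [hf, map_add, map_add, map_add, map_add, map_add, map_add, map_add, map_pow, map_mul, map_pow, map_pow, map_pow, map_pow, map_pow, map_pow, map_pow, he5,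
      show (0 : Fin 6) = Fin.castSucc (0 : Fin 5) from rfl, show (1 : Fin 6) = Fin.castSucc (1 : Fin 5) from rfl,
      show (2 : Fin 6) = Fin.castSucc (2 : Fin 5) from rfl, show (3 : Fin 6) = Fin.castSucc (3 : Fin 5) from rfl,
      show (4 : Fin 6) = Fin.castSucc (4 : Fin 5) from rfl, hej, hej, hej, hej, hej, hb, hc]
    simp only [map_add, map_pow]
    ring
  set a : Fin 5 → k := ![0, 0, 1, 1, 0] with ha
  have h2 : (2 : k) = 0 := by simpa using CharP.cast_eq_zero k 2
  have h3 : (3 : k) = 1 := by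
    calc (3 : k) = 2 + 1 := by norm_num
      _ = 1 := by rw [h2]; ring
  have hba : MvPolynomial.eval a b = 0 := by
    rw [hb, map_pow, eval_X, ha]
    simp
  have hca : MvPolynomial.eval a c = 0 := by
    rw [hc]
    simp only [map_add, map_pow, eval_X, ha, Matrix.cons_val_zero, Matrix.cons_val_one]
    simp only [Matrix.cons_val, one_pow, zero_pow (by norm_num : (13 : ℕ) ≠ 0), zero_pow (by norm_num : (14 : ℕ) ≠ 0), zero_pow (by norm_num : (3 : ℕ) ≠ 0), zero_pow (by norm_num : (7 : ℕ) ≠ 0),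
      add_zero, zero_add]
    rw [show (1 : k) + 1 = 2 by norm_num, h2]
  have hder : MvPolynomial.eval a (pderiv 2 c) ≠ 0 := by
    have e1 : pderiv 2 c = 3 * X 2 ^ 2 := by
      rw [hc]
      simp only [map_add, pderiv_pow, pderiv_X_self, pderiv_X_of_ne (show (1 : Fin 5) ≠ 2 by decide),
        pderiv_X_of_ne (show (0 : Fin 5) ≠ 2 by decide), pderiv_X_of_ne (show (3 : Fin 5) ≠ 2 by decide), pderiv_X_of_ne (show (4 : Fin 5) ≠ 2 by decide),
        mul_zero, zero_add, add_zero, mul_one]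
      push_cast
      ring
    rw [e1, map_mul, map_pow, eval_X, ha]
    simp only [Matrix.cons_val]
    rw [map_ofNat, h3]
    simp
  have hirr : Irreducible (e f) := by
    rw [hef]
    exact Literature.AlgebraicGeometry.Motives.SmoothHypersurface.irreducible_X_pow_add_C_mul_X_add_C (d := 2) le_rfl b c a hba hca 2 hder
  exact (MulEquiv.prime_iff e).mp hirr.prime

/-- ★ **`(k[X]/(f′))_P` is regular at every prime `P ⊉ (x̄, ȳ, ū, t̄, s̄, z̄)`** (= the class rows' `hreg`): some variable other than `z` misses `P` (`z² = f′ − x⁶z − x¹³ − x¹⁴ − y³ − u³ − t³`),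
and then the partial `x⁴` (`∂_z`), `y²`, `u²` or `t²` misses `P` (Jacobian criterion). [cite: Hartshorne1977, I Thm. 5.1] -/
theorem regular_off_vertex (k : Type) [Field k] [CharP k 2] (f : MvPolynomial (Fin 6) k)
    (hf : f = X 5 ^ 2 + X 0 ^ 6 * X 5 + X 0 ^ 13 + X 0 ^ 14 + X 1 ^ 3 + X 2 ^ 3 + X 3 ^ 3 + X 4 ^ 7)
    (P : Ideal (MvPolynomial (Fin 6) k ⧸ Ideal.span {f})) [P.IsPrime]
    (hP : ¬ Ideal.span (Set.range fun j : Fin 6 => Ideal.Quotient.mk (Ideal.span {f}) (X j)) ≤ P) :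
    IsRegularLocalRing (Localization.AtPrime P) := by
  have hP' : (P.comap (Ideal.Quotient.mk (Ideal.span {f}))).IsPrime := Ideal.comap_isPrime _ _
  set P' := P.comap (Ideal.Quotient.mk (Ideal.span {f})) with hP'def
  have hex : ∃ j : Fin 6, j ≠ 5 ∧ (X j : MvPolynomial (Fin 6) k) ∉ P' := by
    by_contra hall
    push Not at hall
    apply hP
    rw [Ideal.span_le]
    rintro _ ⟨j, rfl⟩
    change X j ∈ P'
    by_cases hj : j = 5
    · subst hj
      have hfP : f ∈ P' := FermatCubicConeChar2.self_mem_comap f P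
      have hx : (X 0 : MvPolynomial (Fin 6) k) ∈ P' := hall 0 (by decide)
      have hy : (X 1 : MvPolynomial (Fin 6) k) ∈ P' := hall 1 (by decide)
      have hu : (X 2 : MvPolynomial (Fin 6) k) ∈ P' := hall 2 (by decide)
      have ht : (X 3 : MvPolynomial (Fin 6) k) ∈ P' := hall 3 (by decide)
      have hs : (X 4 : MvPolynomial (Fin 6) k) ∈ P' := hall 4 (by decide)
      have hz2 : (X 5 : MvPolynomial (Fin 6) k) ^ 2 ∈ P' := by
        have e : (X 5 : MvPolynomial (Fin 6) k) ^ 2 = f - (X 0 ^ 6 * X 5 + X 0 ^ 13 + X 0 ^ 14 + X 1 ^ 3 + X 2 ^ 3 + X 3 ^ 3 + X 4 ^ 7) := by rw [hf]; ring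
        rw [e]
        refine Ideal.sub_mem _ hfP (Ideal.add_mem _ (Ideal.add_mem _ (Ideal.add_mem _ (Ideal.add_mem _ (Ideal.add_mem _ (Ideal.add_mem _ ?_ ?_) ?_) ?_) ?_) ?_) ?_)
        · exact Ideal.mul_mem_right _ _ (Ideal.pow_mem_of_mem _ hx 6 (by norm_num))
        · exact Ideal.pow_mem_of_mem _ hx 13 (by norm_num)
        · exact Ideal.pow_mem_of_mem _ hx 14 (by norm_num)
        · exact Ideal.pow_mem_of_mem _ hy 3 (by norm_num)
        · exact Ideal.pow_mem_of_mem _ hu 3 (by norm_num)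
        · exact Ideal.pow_mem_of_mem _ ht 3 (by norm_num)
        · exact Ideal.pow_mem_of_mem _ hs 7 (by norm_num)
      exact hP'.mem_of_pow_mem 2 hz2
    · exact hall j hj
  obtain ⟨j, hj5, hj⟩ := hex
  by_cases hj0 : j = 0
  · subst hj0
    exact HypersurfaceRegular.stub_hypersurfaceRegularOfPderiv k 6 f 5 P
      (by rw [pderiv_five_f k f hf]; exact fun h => hj (hP'.mem_of_pow_mem 6 h))
  · by_cases hj4 : j = 4
    · subst hj4
      exact HypersurfaceRegular.stub_hypersurfaceRegularOfPderiv k 6 f 4 P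
        (by rw [pderiv_four_f k f hf]; exact fun h => hj (hP'.mem_of_pow_mem 6 h))
    · have hj123 : j = 1 ∨ j = 2 ∨ j = 3 := by
        fin_cases j <;> simp_all
      exact HypersurfaceRegular.stub_hypersurfaceRegularOfPderiv k 6 f j P
        (by rw [pderiv_cube_f k f hf j hj123]; exact fun h => hj (hP'.mem_of_pow_mem 2 h))

/-- `(f′)` is a prime ideal. [plumbing] -/
theorem isPrime_span_f (k : Type) [Field k] [CharP k 2] (f : MvPolynomial (Fin 6) k)
    (hf : f = X 5 ^ 2 + X 0 ^ 6 * X 5 + X 0 ^ 13 + X 0 ^ 14 + X 1 ^ 3 + X 2 ^ 3 + X 3 ^ 3 + X 4 ^ 7) : (Ideal.span {f}).IsPrime :=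
  (Ideal.span_singleton_prime (prime_f k f hf).ne_zero).mpr (prime_f k f hf)

/-- `f′ ∉ (Xᵢ)` for every `i`: evaluate at a coordinate point with `Xᵢ = 0` where `f′ = 1` (`e_y`, resp. `e_u` for `i = y`). [folklore] -/
theorem f_not_mem_span_X (k : Type) [Field k] (f : MvPolynomial (Fin 6) k) (hf : f = X 5 ^ 2 + X 0 ^ 6 * X 5 + X 0 ^ 13 + X 0 ^ 14 + X 1 ^ 3 + X 2 ^ 3 + X 3 ^ 3 + X 4 ^ 7) :
    ∀ i : Fin 6, f ∉ Ideal.span {(X i : MvPolynomial (Fin 6) k)} := by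
  intro i h
  rw [Ideal.mem_span_singleton] at h
  obtain ⟨c, hc⟩ := h
  by_cases hi : i = 1
  · subst hi
    have := congrArg (MvPolynomial.eval (Pi.single 2 1 : Fin 6 → k)) hc
    rw [hf] at this
    simp at this
  · have := congrArg (MvPolynomial.eval (Pi.single 1 1 : Fin 6 → k)) hc
    rw [hf] at this
    have h1 : (Pi.single 1 1 : Fin 6 → k) i = 0 := by rw [Pi.single_apply, if_neg hi]
    simp [h1] at this

/-- ★ **No variable vanishes in `k[X]/(f′)`** (the class rows' binder `hXne`). [plumbing] -/
theorem mk_X_ne_zero (k : Type) [Field k] [CharP k 2] (f : MvPolynomial (Fin 6) k) (hf : f = X 5 ^ 2 + X 0 ^ 6 * X 5 + X 0 ^ 13 + X 0 ^ 14 + X 1 ^ 3 + X 2 ^ 3 + X 3 ^ 3 + X 4 ^ 7)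
    (i : Fin 6) : Ideal.Quotient.mk (Ideal.span {f}) (X i) ≠ 0 := fun h0 =>
  PrimeTransfer.X_not_mem_span_of_isPrime (isPrime_span_f k f hf) (f_not_mem_span_X k f hf i) (Ideal.Quotient.eq_zero_iff_mem.mp h0)

/-! ## §2 ★★ Weak non-degeneracy along every positive weight -/

/-- The support of `f′`: every exponent is one of `2e_z, 6e_x + e_z, 13e_x, 14e_x, 3e_y, 3e_u, 3e_t, 7e_s` (as `Finsupp.single`s; `z = X 5`, `s = X 4`). [folklore] -/
theorem support_subset (k : Type) [Field k] (f : MvPolynomial (Fin 6) k) (hf : f = X 5 ^ 2 + X 0 ^ 6 * X 5 + X 0 ^ 13 + X 0 ^ 14 + X 1 ^ 3 + X 2 ^ 3 + X 3 ^ 3 + X 4 ^ 7) :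
    ∀ α ∈ f.support, α = Finsupp.single 5 2 ∨ α = Finsupp.single 0 6 + Finsupp.single 5 1 ∨ α = Finsupp.single 0 13 ∨ α = Finsupp.single 0 14 ∨
      α = Finsupp.single 1 3 ∨ α = Finsupp.single 2 3 ∨ α = Finsupp.single 3 3 ∨ α = Finsupp.single 4 7 := by
  classical
  have hf' : f = monomial (Finsupp.single 5 2) 1 + monomial (Finsupp.single 0 6 + Finsupp.single 5 1) 1 + monomial (Finsupp.single 0 13) 1 +
      monomial (Finsupp.single 0 14) 1 + monomial (Finsupp.single 1 3) 1 + monomial (Finsupp.single 2 3) 1 + monomial (Finsupp.single 3 3) 1 +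
      monomial (Finsupp.single 4 7) 1 := by
    rw [hf]; simp only [X_pow_eq_monomial]; rw [X, monomial_mul, mul_one]
  intro α hα
  rw [hf'] at hα
  rcases Finset.mem_union.mp (support_add hα) with h | h
  · rcases Finset.mem_union.mp (support_add h) with h | h
    · rcases CensusBedsWeaklyNondegenerate.mem_support_add6 h with h | h | h | h | h | h
      · exact Or.inl (CensusBedsWeaklyNondegenerate.eq_of_mem_support_monomial h)
      · exact Or.inr (Or.inl (CensusBedsWeaklyNondegenerate.eq_of_mem_support_monomial h))
      · exact Or.inr (Or.inr (Or.inl (CensusBedsWeaklyNondegenerate.eq_of_mem_support_monomial h)))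
      · exact Or.inr (Or.inr (Or.inr (Or.inl (CensusBedsWeaklyNondegenerate.eq_of_mem_support_monomial h))))
      · exact Or.inr (Or.inr (Or.inr (Or.inr (Or.inl (CensusBedsWeaklyNondegenerate.eq_of_mem_support_monomial h)))))
      · exact Or.inr (Or.inr (Or.inr (Or.inr (Or.inr (Or.inl (CensusBedsWeaklyNondegenerate.eq_of_mem_support_monomial h))))))
    · exact Or.inr (Or.inr (Or.inr (Or.inr (Or.inr (Or.inr (Or.inl (CensusBedsWeaklyNondegenerate.eq_of_mem_support_monomial h)))))))
  · exact Or.inr (Or.inr (Or.inr (Or.inr (Or.inr (Or.inr (Or.inr (CensusBedsWeaklyNondegenerate.eq_of_mem_support_monomial h)))))))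

/-- The vertex `x¹³` IS in the support of `f′` (it dominates `x¹⁴`). [folklore] -/
theorem single_nine_mem_support (k : Type) [Field k] (f : MvPolynomial (Fin 6) k) (hf : f = X 5 ^ 2 + X 0 ^ 6 * X 5 + X 0 ^ 13 + X 0 ^ 14 + X 1 ^ 3 + X 2 ^ 3 + X 3 ^ 3 + X 4 ^ 7) :
    Finsupp.single (0 : Fin 6) 13 ∈ f.support := by
  classical
  rw [mem_support_iff, hf]
  have hmix : (X 0 : MvPolynomial (Fin 6) k) ^ 6 * X 5 = monomial (Finsupp.single 0 6 + Finsupp.single 5 1) 1 := by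
    rw [X_pow_eq_monomial, X, monomial_mul, mul_one]
  have hne : Finsupp.single (0 : Fin 6) 6 + Finsupp.single 5 1 ≠ Finsupp.single 0 13 := fun h => by
    have := DFunLike.congr_fun h 0; simp at this
  simp only [coeff_add, coeff_X_pow, hmix, coeff_monomial, Finsupp.single_eq_single_iff, if_neg hne]
  simp (config := { decide := true })

/-- ★★ **`f′ = z² + x⁶z + x¹³ + x¹⁴ + y³ + u³ + t³ + s⁷` (char 2) IS WEAKLY NON-DEGENERATE ALONG EVERY POSITIVE WEIGHT** (good support, version 2: `β₀ = 2e_z`; `x⁶z` good via `z`,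
`x¹³` via `x`, `y³, u³, t³, s⁷` in private variables; `x¹⁴` dominated by `x¹³`).
[OURS · elementary certificate; cite: BoubakriGreuelMarkwig2010, §3 (p. 10)] -/
theorem weaklyNondegenerate (k : Type) [Field k] [CharP k 2] (f : MvPolynomial (Fin 6) k)
    (hf : f = X 5 ^ 2 + X 0 ^ 6 * X 5 + X 0 ^ 13 + X 0 ^ 14 + X 1 ^ 3 + X 2 ^ 3 + X 3 ^ 3 + X 4 ^ 7) :
    ∀ w : Fin 6 → ℝ, (∀ i, 0 < w i) → IsWeaklyNondegenerateAlong w (f : MvPowerSeries (Fin 6) k) := by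
  classical
  have hsupp := support_subset k f hf
  have h9 := single_nine_mem_support k f hf
  have h2 : (2 : k) = 0 := by simpa using CensusBedsWeaklyNondegenerate.natCast_eq_zero_of_dvd (k := k) 2 2 dvd_rfl
  have h3 : ((3 : ℕ) : k) ≠ 0 := CensusBedsWeaklyNondegenerate.natCast_ne_zero_of_not_dvd 2 3 (by norm_num)
  have h9k : ((13 : ℕ) : k) ≠ 0 := CensusBedsWeaklyNondegenerate.natCast_ne_zero_of_not_dvd 2 13 (by norm_num)
  have h7 : ((7 : ℕ) : k) ≠ 0 := CensusBedsWeaklyNondegenerate.natCast_ne_zero_of_not_dvd 2 7 (by norm_num)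
  have h4 : (6 : k) = 0 := by simpa using CensusBedsWeaklyNondegenerate.natCast_eq_zero_of_dvd (k := k) 2 6 (by norm_num)
  have h10 : (14 : k) = 0 := by simpa using CensusBedsWeaklyNondegenerate.natCast_eq_zero_of_dvd (k := k) 2 14 (by norm_num)
  have dom10 : ∃ γ ∈ f.support, γ ≤ (Finsupp.single 0 14 : Fin 6 →₀ ℕ) ∧ γ ≠ Finsupp.single 0 14 :=
    ⟨_, h9, fun j => by fin_cases j <;> simp, fun h => by have := DFunLike.congr_fun h 0; simp at this⟩
  refine CensusBedsWeaklyNondegenerate.weaklyNondegenerate_of_good_support' f (prime_f k f hf).ne_zero (Finsupp.single 5 2) (fun α hα hne => ?_)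
  rcases hsupp α hα with rfl | rfl | rfl | rfl | rfl | rfl | rfl | rfl
  · exact (hne rfl).elim
  · refine Or.inr ⟨5, by simp, fun β hβ hβne => ?_⟩
    rcases hsupp β hβ with rfl | rfl | rfl | rfl | rfl | rfl | rfl | rfl
    · exact Or.inl (by simp [h2])
    · exact (hβne rfl).elim
    · exact Or.inl (by simp)
    · exact Or.inl (by simp)
    · exact Or.inl (by simp)
    · exact Or.inl (by simp)
    · exact Or.inl (by simp)
    · exact Or.inl (by simp)
  · refine Or.inr ⟨0, by simpa using h9k, fun β hβ hβne => ?_⟩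
    rcases hsupp β hβ with rfl | rfl | rfl | rfl | rfl | rfl | rfl | rfl
    · exact Or.inl (by simp)
    · exact Or.inl (by simp [h4])
    · exact (hβne rfl).elim
    · exact Or.inr dom10
    · exact Or.inl (by simp)
    · exact Or.inl (by simp)
    · exact Or.inl (by simp)
    · exact Or.inl (by simp)
  · exact Or.inl dom10
  · refine Or.inr ⟨1, by simpa using h3, fun β hβ hβne => ?_⟩
    rcases hsupp β hβ with rfl | rfl | rfl | rfl | rfl | rfl | rfl | rfl
    · exact Or.inl (by simp)
    · exact Or.inl (by simp)
    · exact Or.inl (by simp)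
    · exact Or.inl (by simp)
    · exact (hβne rfl).elim
    · exact Or.inl (by simp)
    · exact Or.inl (by simp)
    · exact Or.inl (by simp)
  · refine Or.inr ⟨2, by simpa using h3, fun β hβ hβne => ?_⟩
    rcases hsupp β hβ with rfl | rfl | rfl | rfl | rfl | rfl | rfl | rfl
    · exact Or.inl (by simp)
    · exact Or.inl (by simp)
    · exact Or.inl (by simp)
    · exact Or.inl (by simp)
    · exact Or.inl (by simp)
    · exact (hβne rfl).elim
    · exact Or.inl (by simp)
    · exact Or.inl (by simp)
  · refine Or.inr ⟨3, by simpa using h3, fun β hβ hβne => ?_⟩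
    rcases hsupp β hβ with rfl | rfl | rfl | rfl | rfl | rfl | rfl | rfl
    · exact Or.inl (by simp)
    · exact Or.inl (by simp)
    · exact Or.inl (by simp)
    · exact Or.inl (by simp)
    · exact Or.inl (by simp)
    · exact Or.inl (by simp)
    · exact (hβne rfl).elim
    · exact Or.inl (by simp)
  · refine Or.inr ⟨4, by simpa using h7, fun β hβ hβne => ?_⟩
    rcases hsupp β hβ with rfl | rfl | rfl | rfl | rfl | rfl | rfl | rfl
    · exact Or.inl (by simp)
    · exact Or.inl (by simp)
    · exact Or.inl (by simp)
    · exact Or.inl (by simp)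
    · exact Or.inl (by simp)
    · exact Or.inl (by simp)
    · exact Or.inl (by simp)
    · exact (hβne rfl).elim

end Summit.ResolutionOfSingularities.ResolutionOfSingularities.Theorems.FInjectiveMacaulayfication.Sigma7Lx6q7d5Specimen

end
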